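import Mathlib.AlgebraicGeometry.EllipticCurve.DivisionPolynomial.Basic
import Mathlib.Analysis.SpecialFunctions.Log.PosLog
import Mathlib.Analysis.SpecificLimits.Basic
import Mathlib.NumberTheory.Ostrowski
import Mathlib.NumberTheory.Padics.HeightOneSpectrum
import Literature.NumberTheory.EllipticCurves.Heights
import HarnessLib

/-!
# Néron local height functions on `E(K)` (Tate's series), and the local decomposition of `ĥ`

Topic `NumberTheory/EllipticCurves` (family `abc`, G06; also `bsd`). Bottom layer of the
decomposition of the named fact `Literature.NumberTheory.EllipticCurves.szpiro_imp_langHeightLowerBoundConjecture`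
(Hindry–Silverman 1988, Thm. 0.3 / Petsche 2006, Thm. 2: Szpiro ⇒ Lang's height lower bound),
whose printed proofs estimate the canonical height place by place through the **Néron local
height functions** `λ_v` and the **local decomposition** `ĥ = Σ_v (n_v/[K:ℚ]) λ_v`
(Silverman, *Advanced Topics in the Arithmetic of Elliptic Curves* (ATAEC), Ch. VI).

For a Weierstrass curve `W` over a field `K` and a real absolute value `v : AbsoluteValue K ℝ` we
define, following **Tate's construction in the proof of ATAEC Thm. VI.1.1** (pp. 455–458 of the
printed book) word for word:

* `naiveLocalHeight v P = λ₁(P) = ½ max{v(x(P)⁻¹), 0} = ½ log⁺ |x(P)|_v` (and `0` at `O`);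
* `tateCorrection v P = f(P) = ½ log (max{|φ(P)|_v, |ψ(P)|_v} / max{|x(P)|_v⁴, 1}) + ¼ v(Δ)`,
  Tate's bounded correction (ATAEC Lemma VI.1.2), where `φ = X⁴ − b₄X² − 2b₆X − b₈ = W.Φ 2` and
  `ψ = 4X³ + b₂X² + 2b₄X + b₆ = W.Ψ₂Sq` (Mathlib's division polynomials; `x(2P) = φ/ψ`), extended
  to `O` by its limit `f(O) = ¼ v(Δ)` (loc. cit.: `F(P) → 1` as `P → O`);
* `tateMu v P = μ(P) = Σ_{n ≥ 0} 4^{-(n+1)} f(2ⁿP)` (ATAEC Prop. VI.1.3, Tate's telescoping series);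
* `neronLocalHeight v P = λ(P) = λ₁(P) + μ(P)` (ATAEC, end of the proof of Thm. VI.1.1, p. 458),
  the Néron local height function attached to `v`, in Silverman's normalisation
  (`λ(2P) = 4λ(P) + v(2y + a₁x + a₃) − ¼ v(Δ)`); as a function on the curve it does not depend on
  the chosen Weierstrass equation (ATAEC VI.1.1(b)). Here `v(·) = −log |·|_v`.

Completeness of `K` is used in ATAEC only for the uniqueness statement VI.1.1(a); the construction
makes sense for any absolute value, and for `K = ℚ ⊂ ℚ_v` it is literally the restriction of the
construction over `ℚ_v` (same series), which is how the functions `λ_v|_{E(k)}` of Petsche 2006, §2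
and Hindry–Silverman 1988 arise.

We then record as named facts (D-0014): Tate's Lemma VI.1.2 (`f` is bounded), the duplication
property VI.1.1(a)(iii) — which we also **prove** from Lemma VI.1.2 (`neronLocalHeight_two_nsmul_of`,
via Tate's telescoping identity and the duplication formula `x(2P) = φ/ψ`) — and the local
decomposition theorem VI.2.1 over `ℚ`
(`canonicalHeight P = 2 · (λ_∞(P) + Σ_p λ_p(P))`; the factor `2` because the tree's
`canonicalHeight` is normalised without Silverman's `½`, see `Heights.lean`). For the places of
`ℚ` we use Mathlib's `Rat.AbsoluteValue.real` and `Rat.AbsoluteValue.padic` (`Ostrowski.lean`),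
the latter packaged as `Rat.HeightOneSpectrum.padicAbv v` for a height-one prime `v` of `ℤ`
(`p = Rat.HeightOneSpectrum.natGenerator v`), matching the indexing of
`WeierstrassCurve.conductorExponent`, `WeierstrassCurve.ordMinimalDiscriminant` (A = `ℤ`).

## Design choices

* Namespace `WeierstrassCurve.Affine.Point` (deliberate dot-notation extension of Mathlib, as in
  `Heights.lean`): `P.neronLocalHeight v`.
* Values at `O`: ATAEC's `λ` lives on `E(K) ∖ {O}`; we set `λ₁(O) = 0` and `f(O) = ¼ v(Δ)` (its
  genuine limit), so that `λ(O) = μ(O) = (1/12) v(Δ) = −(1/12) log |Δ|_v` (`neronLocalHeight_zero`), a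
  documented junk value never used by the facts (all stated for `P ≠ O`).
* `tateMu` is a `tsum` (junk value `0` if not summable; summability follows from the boundedness
  fact `tateCorrection_bounded`, ATAEC Lemma VI.1.2, see `summable_tateMu_of`).
* Mathlib search: no local/Néron height for elliptic curves in Mathlib or `Literature/`
  (`lean search 'neron.*eight|local height'`: only `canonicalHeight`, unrelated GLₙ adelic heights,
  `p`-adic heights). Mathlib provides `Real.posLog` (`log⁺`), `W.Φ 2`, `W.Ψ₂Sq`,
  `Rat.AbsoluteValue.padic/real`, `Rat.HeightOneSpectrum.natGenerator`.

## References

* J. H. Silverman, *Advanced Topics in the Arithmetic of Elliptic Curves*, GTM 151 (1994), Ch. VI: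
  Thm. VI.1.1 and its proof (pp. 455–458), Lemma VI.1.2, Prop. VI.1.3, Thm. VI.2.1 (p. 461),
  Thm. VI.3.2, VI.3.4, VI.4.1.
* J. Tate, letter to Serre (1979) (the series for `λ`); J. H. Silverman, *Computing heights on
  elliptic curves*, Math. Comp. 51 (1988), 339–358.
* C. Petsche, New York J. Math. 12 (2006), §2; M. Hindry, J. H. Silverman, Invent. Math. 93 (1988).
-/

noncomputable section

open scoped Classical

open Polynomial

/-! ### The `p`-adic absolute value attached to a height-one prime of `ℤ` -/

namespace Rat.HeightOneSpectrum

open IsDedekindDomain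

variable {R : Type*} [CommRing R] [Algebra R ℚ] [IsIntegralClosure R ℤ ℚ]

/-- The real-valued `p`-adic absolute value `|·|_p` of `ℚ` attached to a height-one prime `v` of a
ring of integers `R` of `ℚ` (`R = ℤ` or `𝓞 ℚ`), `p = natGenerator v`: Mathlib's
`Rat.AbsoluteValue.padic p` with its `Fact p.Prime` argument supplied by `prime_natGenerator`
(Mathlib registers that instance only locally). Normalisation `|p|_p = p⁻¹`, the standard one of
`M_ℚ` (Silverman AEC VIII.5). (Extension of the Mathlib namespace `Rat.HeightOneSpectrum`.)
[folklore] -/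
def padicAbv (v : HeightOneSpectrum R) : AbsoluteValue ℚ ℝ :=
  @Rat.AbsoluteValue.padic (natGenerator v) ⟨prime_natGenerator v⟩

/-- Unfolding: `padicAbv v x = padicNorm p x`, `p = natGenerator v`. [folklore] -/
theorem padicAbv_apply (v : HeightOneSpectrum R) (x : ℚ) :
    padicAbv v x = (padicNorm (natGenerator v) x : ℝ) := rfl

/-- `|n|_p ≤ 1` for integers `n`. [folklore] -/
theorem padicAbv_intCast_le_one (v : HeightOneSpectrum R) (n : ℤ) : padicAbv v n ≤ 1 :=
  @Rat.AbsoluteValue.padic_le_one (natGenerator v) ⟨prime_natGenerator v⟩ n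

end Rat.HeightOneSpectrum

namespace WeierstrassCurve.Affine.Point

section Defs

variable {K : Type*} [Field K] (v : AbsoluteValue K ℝ) {W : WeierstrassCurve K}

/-- Tate's **naive local height** `λ₁(P) = ½ max{v(x(P)⁻¹), 0} = ½ log⁺ |x(P)|_v`
(`v(t) = −log |t|_v`), the first approximation to the Néron local height in the proof of
ATAEC Thm. VI.1.1 (p. 456); `λ₁(O) = 0` by convention. [cite: Silverman1994, proof of Thm VI.1.1] -/
def naiveLocalHeight : W.toAffine.Point → ℝ
  | 0 => 0
  | some x _ _ => 1 / 2 * Real.posLog (v x)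

/-- **Tate's correction term** `f(P) = λ₁(2P) − 4λ₁(P) − v((2y + a₁x + a₃)(P)) + ¼ v(Δ)`, in the
closed form of ATAEC (proof of Thm. VI.1.1 and Lemma VI.1.2, pp. 456–457):
`f(P) = ½ log (max{|φ(P)|_v, |ψ(P)|_v} / max{|x(P)|_v⁴, 1}) + ¼ v(Δ)` with
`φ = X⁴ − b₄X² − 2b₆X − b₈` (Mathlib `W.Φ 2`) and `ψ = 4X³ + b₂X² + 2b₄X + b₆ = (2y + a₁x + a₃)²`
(Mathlib `W.Ψ₂Sq`), so that `x(2P) = φ(P)/ψ(P)`; at `O` we take the limiting value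
`f(O) = ¼ v(Δ) = −¼ log |Δ|_v` (Lemma VI.1.2: the quotient tends to `1`). The closed form is
defined at every point (including `2`-torsion), which is how Lemma VI.1.2 extends `f`.
[cite: Silverman1994, Lemma VI.1.2] -/
def tateCorrection : W.toAffine.Point → ℝ
  | 0 => -(1 / 4 * Real.log (v W.Δ))
  | some x _ _ =>
      1 / 2 * Real.log (max (v ((W.Φ 2).eval x)) (v (W.Ψ₂Sq.eval x)) / max (v x ^ 4) 1) -
        1 / 4 * Real.log (v W.Δ)

/-- **Tate's series** `μ(P) = Σ_{n ≥ 0} 4^{-(n+1)} f(2ⁿ P)` (ATAEC Prop. VI.1.3 and its proof,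
pp. 457–458), the unique bounded solution of `f(P) = 4μ(P) − μ(2P)` when `f` is bounded. A `tsum`
(absolutely convergent by Lemma VI.1.2; junk value `0` otherwise). [cite: Silverman1994, Prop VI.1.3] -/
def tateMu (P : W.toAffine.Point) : ℝ :=
  ∑' n : ℕ, (1 / 4 : ℝ) ^ (n + 1) * tateCorrection v ((2 ^ n) • P)

/-- The **Néron local height function** `λ_v : E(K) → ℝ` attached to the absolute value `v`, as
constructed by Tate in the proof of ATAEC Thm. VI.1.1 (p. 458): `λ = λ₁ + μ`. Over a complete
field it is *the* function of Thm. VI.1.1(a) (continuous and bounded away from `O`,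
`λ + ½ v(x) → lim` at `O`, and `λ(2P) = 4λ(P) + v(2y + a₁x + a₃) − ¼ v(Δ)`), independent of the
Weierstrass equation (VI.1.1(b)) and compatible with field extensions (VI.1.1(c)); over `ℂ` it is
the Néron function of VI.3.2/VI.3.4, and at a non-archimedean `v`, for a `v`-integral equation and
`P ∈ E₀(K)`, it is `½ max{v(x(P)⁻¹), 0} + (1/12) v(Δ)` (VI.4.1). Normalisation: Silverman's (`Σ_v n_v λ_v = [K:ℚ] ĥ`
with `ĥ = ½ h_x + O(1)`). Value at `O`: the junk value `(1/12) v(Δ)` (`neronLocalHeight_zero`).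
[cite: Silverman1994, Thm VI.1.1] -/
def neronLocalHeight (P : W.toAffine.Point) : ℝ :=
  naiveLocalHeight v P + tateMu v P

/-! ### Elementary API (proved) -/

/-- `λ₁(O) = 0` (by definition). [folklore] -/
@[simp]
theorem naiveLocalHeight_zero : naiveLocalHeight v (0 : W.toAffine.Point) = 0 := rfl

/-- `λ₁(P) = ½ log⁺ |x(P)|_v` for an affine point (by definition; ATAEC proof of Thm. VI.1.1).
[cite: Silverman1994, proof of Thm VI.1.1] -/
@[simp]
theorem naiveLocalHeight_some {x y : K} (h : W.toAffine.Nonsingular x y) :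
    naiveLocalHeight v (some x y h) = 1 / 2 * Real.posLog (v x) := rfl

/-- `λ₁(−P) = λ₁(P)` (`x(−P) = x(P)`). [folklore] -/
@[simp]
theorem naiveLocalHeight_neg (P : W.toAffine.Point) :
    naiveLocalHeight v (-P) = naiveLocalHeight v P := by
  cases P <;> rfl

/-- `λ₁ ≥ 0`. [folklore] -/
theorem naiveLocalHeight_nonneg (P : W.toAffine.Point) : 0 ≤ naiveLocalHeight v P := by
  cases P with
  | zero => exact le_rfl
  | some x y h =>
    rw [naiveLocalHeight_some]
    exact mul_nonneg (by norm_num) Real.posLog_nonneg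

/-- `f(O) = ¼ v(Δ) = −¼ log |Δ|_v` (by definition, the limiting value of ATAEC Lemma VI.1.2).
[cite: Silverman1994, Lemma VI.1.2] -/
@[simp]
theorem tateCorrection_zero :
    tateCorrection v (0 : W.toAffine.Point) = -(1 / 4 * Real.log (v W.Δ)) := rfl

/-- Tate's closed form of `f` at an affine point (by definition; ATAEC proof of Thm. VI.1.1,
p. 456). [cite: Silverman1994, Lemma VI.1.2] -/
theorem tateCorrection_some {x y : K} (h : W.toAffine.Nonsingular x y) :
    tateCorrection v (some x y h) =
      1 / 2 * Real.log (max (v ((W.Φ 2).eval x)) (v (W.Ψ₂Sq.eval x)) / max (v x ^ 4) 1) -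
        1 / 4 * Real.log (v W.Δ) := rfl

/-- `f(−P) = f(P)` (`f` depends on `x(P)` only). [folklore] -/
@[simp]
theorem tateCorrection_neg (P : W.toAffine.Point) :
    tateCorrection v (-P) = tateCorrection v P := by
  cases P <;> rfl

/-- `μ(−P) = μ(P)` (`2ⁿ(−P) = −2ⁿP` and `f` is even). [folklore] -/
@[simp]
theorem tateMu_neg (P : W.toAffine.Point) : tateMu v (-P) = tateMu v P := by
  unfold tateMu
  simp_rw [smul_neg, tateCorrection_neg]

/-- The Néron local height is even: `λ(−P) = λ(P)` (ATAEC Thm. VI.1.1: `λ` depends on `x(P)`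
through `λ₁` and `f`). [cite: Silverman1994, Thm VI.1.1] -/
@[simp]
theorem neronLocalHeight_neg (P : W.toAffine.Point) :
    neronLocalHeight v (-P) = neronLocalHeight v P := by
  simp [neronLocalHeight]

/-- `μ(O) = Σ_{n≥0} 4^{-(n+1)} f(O) = f(O)/3`. [folklore] -/
theorem tateMu_zero : tateMu v (0 : W.toAffine.Point) = -(1 / 12 * Real.log (v W.Δ)) := by
  unfold tateMu
  simp_rw [smul_zero, tateCorrection_zero, pow_succ, mul_assoc]
  rw [tsum_mul_right, tsum_geometric_of_lt_one (by norm_num) (by norm_num)]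
  ring

/-- The (junk) value at `O`: `λ(O) = (1/12) v(Δ) = −(1/12) log |Δ|_v`. [folklore] -/
theorem neronLocalHeight_zero :
    neronLocalHeight v (0 : W.toAffine.Point) = -(1 / 12 * Real.log (v W.Δ)) := by
  rw [neronLocalHeight, naiveLocalHeight_zero, tateMu_zero, zero_add]

/-! ### Named facts: Tate's lemma, duplication, and the summability they give -/

variable (W)

/-- **ATAEC Lemma VI.1.2** (Tate; p. 457): for an elliptic curve, Tate's correction `f` *extends to
a bounded (continuous) function on all of `E(K)`*: there is `C` with `|f(P)| ≤ C` for all `P`.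
The printed proof: `φ` and `ψ` are coprime (`Res(φ, ψ) = Δ² ≠ 0`), so `max{|φ|_v, |ψ|_v}` is
bounded below on `|x|_v ≤ c₁`, and the quotient tends to `1` at `O`. Valid for any absolute value
(completeness is not used). [cite: Silverman1994, Lemma VI.1.2] -/
def tateCorrection_bounded : Prop :=
  ∀ [W.IsElliptic], ∃ C : ℝ, ∀ P : W.toAffine.Point, |tateCorrection v P| ≤ C

/-- **ATAEC Thm. VI.1.1(a)(iii)** (Néron, Tate; p. 455, proof p. 458): the duplication formula
for the Néron local height, *for all `P ∈ E(K)` with `[2]P ≠ O`,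
`λ([2]P) = 4λ(P) + v((2y + a₁x + a₃)(P)) − ¼ v(Δ)`*, i.e. with `v = −log |·|_v`:
`λ(2P) = 4λ(P) − log |2y + a₁x + a₃|_v + ¼ log |Δ|_v`. (From `f = 4μ − μ∘[2]`, Prop. VI.1.3,
and the definition of `f`; needs Lemma VI.1.2 for the convergence of `μ`.)
[cite: Silverman1994, Thm VI.1.1(a)(iii)] -/
def neronLocalHeight_two_nsmul : Prop :=
  ∀ [W.IsElliptic] {x y : K} (h : W.toAffine.Nonsingular x y), (2 : ℕ) • some x y h ≠ 0 →
    neronLocalHeight v ((2 : ℕ) • some x y h) =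
      4 * neronLocalHeight v (some x y h) - Real.log (v (2 * y + W.a₁ * x + W.a₃)) +
        1 / 4 * Real.log (v W.Δ)

variable {W}

/-- Tate's series converges absolutely once `f` is bounded (ATAEC, proof of Prop. VI.1.3: "since
`f` is bounded, the series is absolutely convergent"). [cite: Silverman1994, Prop VI.1.3] -/
theorem summable_tateMu_of [W.IsElliptic] (hf : tateCorrection_bounded v W) (P : W.toAffine.Point) :
    Summable fun n : ℕ => (1 / 4 : ℝ) ^ (n + 1) * tateCorrection v ((2 ^ n) • P) := by
  obtain ⟨C, hC⟩ := hf
  have hC0 : 0 ≤ C := le_trans (abs_nonneg _) (hC 0)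
  refine Summable.of_norm_bounded (g := fun n : ℕ => C * (1 / 4 : ℝ) ^ n) ?_ fun n => ?_
  · exact (summable_geometric_of_lt_one (by norm_num) (by norm_num)).mul_left C
  · rw [Real.norm_eq_abs, abs_mul, abs_of_nonneg (by positivity), pow_succ]
    calc (1 / 4 : ℝ) ^ n * (1 / 4) * |tateCorrection v ((2 ^ n) • P)|
        ≤ (1 / 4 : ℝ) ^ n * 1 * C := by
          gcongr
          · norm_num
          · exact hC _
      _ = C * (1 / 4) ^ n := by ring

/-- `|μ(P)| ≤ C/3` when `|f| ≤ C` (ATAEC, proof of Prop. VI.1.3: `μ` is bounded).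
[cite: Silverman1994, Prop VI.1.3] -/
theorem abs_tateMu_le_of [W.IsElliptic] {C : ℝ} (hC : ∀ P : W.toAffine.Point, |tateCorrection v P| ≤ C)
    (P : W.toAffine.Point) : |tateMu v P| ≤ C / 3 := by
  have hC0 : 0 ≤ C := le_trans (abs_nonneg _) (hC 0)
  have hgs : Summable fun n : ℕ => C / 4 * (1 / 4 : ℝ) ^ n :=
    (summable_geometric_of_lt_one (by norm_num) (by norm_num)).mul_left _
  have h34 : (1 - 1 / 4 : ℝ)⁻¹ = 4 / 3 := by norm_num
  have hgt : ∑' n : ℕ, C / 4 * (1 / 4 : ℝ) ^ n = C / 3 := by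
    rw [tsum_mul_left, tsum_geometric_of_lt_one (by norm_num) (by norm_num), h34]
    ring
  have hs : Summable fun n : ℕ => (1 / 4 : ℝ) ^ (n + 1) * tateCorrection v ((2 ^ n) • P) :=
    summable_tateMu_of v ⟨C, hC⟩ P
  have hle : ∀ n : ℕ, ‖(1 / 4 : ℝ) ^ (n + 1) * tateCorrection v ((2 ^ n) • P)‖ ≤
      C / 4 * (1 / 4 : ℝ) ^ n := fun n => by
    rw [Real.norm_eq_abs, abs_mul, abs_of_nonneg (by positivity), pow_succ]
    calc (1 / 4 : ℝ) ^ n * (1 / 4) * |tateCorrection v ((2 ^ n) • P)|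
        ≤ (1 / 4 : ℝ) ^ n * (1 / 4) * C := by gcongr; exact hC _
      _ = C / 4 * (1 / 4) ^ n := by ring
  unfold tateMu
  calc |∑' n : ℕ, (1 / 4 : ℝ) ^ (n + 1) * tateCorrection v ((2 ^ n) • P)|
      ≤ ∑' n : ℕ, ‖(1 / 4 : ℝ) ^ (n + 1) * tateCorrection v ((2 ^ n) • P)‖ :=
        Real.norm_eq_abs _ ▸ norm_tsum_le_tsum_norm hs.norm
    _ ≤ ∑' n : ℕ, C / 4 * (1 / 4 : ℝ) ^ n := Summable.tsum_le_tsum hle hs.norm hgs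
    _ = C / 3 := hgt

/-- **ATAEC Thm. VI.1.1(a)(i)–(ii) in quantitative form**: `λ − λ₁ = μ` is bounded on `E(K)`,
`|λ(P) − ½ log⁺|x(P)|_v| ≤ C/3` when `|f| ≤ C` (so `λ` is bounded away from `O` and
`λ + ½ v(x) → μ(O)` at `O`). This is the local ingredient `−c_v ≤ λ_v − ½ max{v(x⁻¹),0} ≤ c_v` of
the proof of Thm. VI.2.1. [cite: Silverman1994, Thm VI.1.1(a)] -/
theorem abs_neronLocalHeight_sub_naiveLocalHeight_le_of [W.IsElliptic] {C : ℝ}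
    (hC : ∀ P : W.toAffine.Point, |tateCorrection v P| ≤ C) (P : W.toAffine.Point) :
    |neronLocalHeight v P - naiveLocalHeight v P| ≤ C / 3 := by
  rw [neronLocalHeight, add_sub_cancel_left]
  exact abs_tateMu_le_of v hC P

/-- Tate's telescoping identity `4μ(P) − μ(2P) = f(P)` (ATAEC Prop. VI.1.3), given the
boundedness of `f` (Lemma VI.1.2) for convergence. [cite: Silverman1994, Prop VI.1.3] -/
theorem four_mul_tateMu_sub_tateMu_two_nsmul_of [W.IsElliptic] (hf : tateCorrection_bounded v W)
    (P : W.toAffine.Point) :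
    4 * tateMu v P - tateMu v ((2 : ℕ) • P) = tateCorrection v P := by
  have hs := summable_tateMu_of v hf P
  -- `4 μ(P) = Σ_n 4^{-n} f(2ⁿ P)` and `μ(2P) = Σ_n 4^{-(n+1)} f(2^{n+1} P)` is its tail
  set g : ℕ → ℝ := fun n => (1 / 4 : ℝ) ^ n * tateCorrection v ((2 ^ n) • P) with hg
  have h2 : ∀ n : ℕ, (2 ^ n) • ((2 : ℕ) • P) = (2 ^ (n + 1)) • P := fun n => by
    rw [← mul_nsmul', pow_succ]
  have hsg : Summable g :=
    (hs.mul_left 4).congr fun n => by simp only [hg, pow_succ]; ring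
  have h4 : 4 * tateMu v P = ∑' n, g n := by
    rw [tateMu, ← tsum_mul_left]
    exact tsum_congr fun n => by simp only [hg, pow_succ]; ring
  have htail : tateMu v ((2 : ℕ) • P) = ∑' n, g (n + 1) := by
    unfold tateMu
    exact tsum_congr fun n => by simp only [hg, h2 n]
  rw [h4, htail, hsg.tsum_eq_zero_add]
  simp [hg]

end Defs

/-! ### The local decomposition of the canonical height over `ℚ` (ATAEC Thm. VI.2.1) -/

section Rat

open IsDedekindDomain Rat.HeightOneSpectrum

variable (W : WeierstrassCurve ℚ)

/-- **ATAEC Thm. VI.2.1** (local decomposition of the canonical height; p. 461), ground field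
`K = ℚ`: *let `λ_v : E(K_v) ∖ {O} → ℝ` be the local Néron height function for each `v ∈ M_K`;
then `ĥ(P) = (1/[K:ℚ]) Σ_{v ∈ M_K} n_v λ_v(P)` for all `P ∈ E(K) ∖ {O}`*, the sum having only
finitely many non-zero terms (loc. cit., via Lemma VI.2.2). For `K = ℚ`: `M_ℚ` = the real place
(`Rat.AbsoluteValue.real`) and the `p`-adic places (`Rat.HeightOneSpectrum.padicAbv v`,
`v : HeightOneSpectrum ℤ`), all `n_v = 1`; `λ_v` restricted to `E(ℚ)` is `neronLocalHeight`
(same Tate series, VI.1.1(c)); and Silverman's `ĥ = ½ h_x + O(1)` is **half** of the tree's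
`canonicalHeight = lim h_x(2ⁿP)/4ⁿ` (`Heights.lean`, Clay normalisation), whence the factor `2`.
[cite: Silverman1994, Thm VI.2.1] -/
def canonicalHeight_eq_two_mul_sum_neronLocalHeight : Prop :=
  ∀ [W.IsElliptic] (P : W.toAffine.Point), P ≠ 0 →
    (Function.support fun v : HeightOneSpectrum ℤ => neronLocalHeight (padicAbv v) P).Finite ∧
      P.canonicalHeight =
        2 * (neronLocalHeight Rat.AbsoluteValue.real P +
          ∑ᶠ v : HeightOneSpectrum ℤ, neronLocalHeight (padicAbv v) P)

end Rat

/-! ### The duplication formula for Tate's `λ`, from Lemma VI.1.2 -/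

section TwoNsmul

variable {K : Type*} [Field K] (v : AbsoluteValue K ℝ) {W : WeierstrassCurve K}

/-- `(2y + a₁x + a₃)² = ψ(x) = 4x³ + b₂x² + 2b₄x + b₆` on the curve (AEC III.2.3(d); Mathlib's
`Ψ₂Sq` is "congruent to `ψ₂²`"). [cite: SilvermanAEC2009, III.2.3(d)] -/
theorem sub_negY_sq_eq_eval_Ψ₂Sq {x y : K} (h : W.toAffine.Equation x y) :
    (y - W.toAffine.negY x y) ^ 2 = W.Ψ₂Sq.eval x := by
  rw [WeierstrassCurve.Affine.equation_iff] at h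
  simp only [WeierstrassCurve.Affine.negY, WeierstrassCurve.Ψ₂Sq, WeierstrassCurve.b₂,
    WeierstrassCurve.b₄, WeierstrassCurve.b₆, eval_add, eval_mul, eval_C, eval_pow, eval_X]
  linear_combination 4 * h

/-- The duplication formula `x(2P) = φ(x)/ψ(x)` (AEC III.2.3(d)) for `P = (x, y)` with `2P ≠ O`,
`φ = W.Φ 2`, `ψ = W.Ψ₂Sq`. [cite: SilvermanAEC2009, III.2.3(d)] -/
theorem addX_self_eq_eval_div {x y : K} (h : W.toAffine.Equation x y)
    (hy : y ≠ W.toAffine.negY x y) :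
    W.toAffine.addX x x (W.toAffine.slope x x y y) = (W.Φ 2).eval x / W.Ψ₂Sq.eval x := by
  have hd : y - W.toAffine.negY x y ≠ 0 := sub_ne_zero.mpr hy
  have h1 : W.toAffine.addX x x (W.toAffine.slope x x y y) =
      ((3 * x ^ 2 + 2 * W.a₂ * x + W.a₄ - W.a₁ * y) ^ 2 +
        W.a₁ * (3 * x ^ 2 + 2 * W.a₂ * x + W.a₄ - W.a₁ * y) * (y - W.toAffine.negY x y) -
        (W.a₂ + 2 * x) * (y - W.toAffine.negY x y) ^ 2) / (y - W.toAffine.negY x y) ^ 2 := by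
    rw [WeierstrassCurve.Affine.slope_of_Y_ne rfl hy, WeierstrassCurve.Affine.addX]
    field_simp
    ring
  have h2 : (3 * x ^ 2 + 2 * W.a₂ * x + W.a₄ - W.a₁ * y) ^ 2 +
        W.a₁ * (3 * x ^ 2 + 2 * W.a₂ * x + W.a₄ - W.a₁ * y) * (y - W.toAffine.negY x y) -
        (W.a₂ + 2 * x) * (y - W.toAffine.negY x y) ^ 2 = (W.Φ 2).eval x := by
    rw [WeierstrassCurve.Affine.equation_iff] at h
    simp only [WeierstrassCurve.Affine.negY, WeierstrassCurve.Φ_two, WeierstrassCurve.b₄,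
      WeierstrassCurve.b₆, WeierstrassCurve.b₈, eval_sub, eval_mul, eval_C, eval_pow, eval_X]
    linear_combination (-(W.a₁ ^ 2 + 4 * W.a₂ + 8 * x)) * h
  rw [h1, h2, sub_negY_sq_eq_eval_Ψ₂Sq h]

/-- **Discharge of `neronLocalHeight_two_nsmul` from Tate's Lemma VI.1.2** (ATAEC, end of the
proof of Thm. VI.1.1, p. 458): `λ(2P) = λ₁(2P) + μ(2P) = λ₁(2P) − f(P) + 4μ(P)` by the telescoping
identity, and `λ₁(2P) − f(P) = 4λ₁(P) + v(2y + a₁x + a₃) − ¼ v(Δ)` by the duplication formula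
`x(2P) = φ/ψ`, `ψ = (2y + a₁x + a₃)²` and the closed form of `f`. [cite: Silverman1994, Thm VI.1.1(a)(iii)] -/
theorem neronLocalHeight_two_nsmul_of (hf : tateCorrection_bounded v W) :
    neronLocalHeight_two_nsmul v W := by
  intro _ x y h h2
  have hy : y ≠ W.toAffine.negY x y := fun hy => h2 (by rw [two_nsmul, add_self_of_Y_eq hy])
  have h2P : (2 : ℕ) • some x y h = some _ _ (nonsingular_add h h fun hxy => hy hxy.right) := by
    rw [two_nsmul, add_self_of_Y_ne hy]
  have hd : y - W.toAffine.negY x y ≠ 0 := sub_ne_zero.mpr hy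
  have hdy : y - W.toAffine.negY x y = 2 * y + W.a₁ * x + W.a₃ := by
    simp only [WeierstrassCurve.Affine.negY]
    ring
  -- the quantities `a = |φ(x)|`, `b = |ψ(x)| = |2y + a₁x + a₃|²`, `c = |x|`
  set a := v ((W.Φ 2).eval x) with ha
  set b := v (W.Ψ₂Sq.eval x) with hb
  set c := v x with hc
  have hψ : W.Ψ₂Sq.eval x = (2 * y + W.a₁ * x + W.a₃) ^ 2 := by
    rw [← sub_negY_sq_eq_eval_Ψ₂Sq h.1, hdy]
  have he0 : 0 < v (2 * y + W.a₁ * x + W.a₃) := v.pos (hdy ▸ hd)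
  have hbe : b = v (2 * y + W.a₁ * x + W.a₃) ^ 2 := by rw [hb, hψ, map_pow]
  have hb0 : 0 < b := by rw [hbe]; positivity
  have ha0 : 0 ≤ a := v.nonneg _
  have hc0 : 0 ≤ c := v.nonneg _
  have hab : 0 < max a b := lt_max_of_lt_right hb0
  have hc4 : max (c ^ 4) 1 = (max 1 c) ^ 4 := by
    rcases le_total c 1 with h1 | h1
    · rw [max_eq_left h1, one_pow, max_eq_right (pow_le_one₀ hc0 h1)]
    · rw [max_eq_right h1, max_eq_left (one_le_pow₀ h1)]
  have hc4pos : 0 < max (c ^ 4) 1 := lt_max_of_lt_right one_pos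
  -- the four terms
  have hμ := four_mul_tateMu_sub_tateMu_two_nsmul_of v hf (some x y h)
  have hfP : tateCorrection v (some x y h) =
      1 / 2 * (Real.log (max a b) - Real.log (max (c ^ 4) 1)) - 1 / 4 * Real.log (v W.Δ) := by
    rw [tateCorrection_some, Real.log_div hab.ne' hc4pos.ne']
  have hl2 : naiveLocalHeight v ((2 : ℕ) • some x y h) =
      1 / 2 * (Real.log (max a b) - Real.log b) := by
    have hm : max 1 (a / b) = max a b / b := by
      rw [← div_self hb0.ne', max_div_div_right hb0.le, max_comm]
    rw [h2P, naiveLocalHeight_some, addX_self_eq_eval_div h.1 hy, map_div₀, ← ha, ← hb,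
      Real.posLog_eq_log_max_one (div_nonneg ha0 hb0.le), hm, Real.log_div hab.ne' hb0.ne']
  have hl1 : naiveLocalHeight v (some x y h) = 1 / 2 * Real.log (max 1 c) := by
    rw [naiveLocalHeight_some, Real.posLog_eq_log_max_one hc0]
  have hmax : Real.log (max (c ^ 4) 1) = 4 * Real.log (max 1 c) := by
    rw [hc4, Real.log_pow]
    norm_num
  have he : Real.log (v (2 * y + W.a₁ * x + W.a₃)) = 1 / 2 * Real.log b := by
    rw [hbe, Real.log_pow]
    push_cast
    ring
  have hμ' : tateMu v ((2 : ℕ) • some x y h) =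
      4 * tateMu v (some x y h) - tateCorrection v (some x y h) := by
    linarith
  unfold neronLocalHeight
  rw [hl2, hl1, he, hμ', hfP, hmax]
  ring

end TwoNsmul

end WeierstrassCurve.Affine.Point

end
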